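import Mathlib.NumberTheory.NumberField.Ideal.Basic
import Mathlib.RingTheory.Ideal.Norm.AbsNorm
import HarnessLib

/-!
# A principal ideal with a four-element residue ring containing a primitive cube root of unity is prime
# (the residue-field certificate `𝓞/(η) ≅ 𝔽₄` for a dyadic prime element of residue degree `2`)

Topic `NumberTheory/NumberFields` (namespace = path). THEOREM-ONLY file (no definition, no named fact, no instance, no `sorry`), written by
the prover seat `bsd-2adic-k4-w3` GEN 15 (cell `bsd-2adic`; `--supports` stmt-BirchSwinnertonDyer-22618: the layer-two narrow certificates of the
C4″ census need, for cubic `2`-torsion fields in which `2 = 𝔭𝔮` with residue degree `f(𝔮) = 2` — e.g. `d = 469`, row `210112ek1` — the primality of an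
explicit dyadic element `η` of NORM `±4`; the norm alone does not decide it, the residue ring does).  Closes nothing at the `∀`-level.

* `Ideal.isMaximal_of_card_quotient_eq_four` — `R` commutative, `I` an ideal with `#(R/I) = 4`, `2 ∈ I`, and `ζ² + ζ + 1 ∈ I` for some `ζ` ⟹ `I` is
  maximal: in `S = R/I` (characteristic `2`) the class `z` of `ζ` has `z² + z + 1 = 0`, so `0, 1, z, z + 1` are pairwise distinct, hence ALL of `S`, and
  `1·1 = z·(z+1) = 1` — every non-zero element is a unit, `S` is a field (`𝔽₄`).
* `prime_of_absNorm_span_eq_four` — `η ∈ 𝓞 K` with `N((η)) = 4`, `η ∣ 2` and `η ∣ ζ² + ζ + 1` ⟹ `(η)` is a prime ideal and `η` is a prime element.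

References: [Marcus1977] Ch. 3 Thm. 22 (c) (`‖(α)‖ = |N(α)|`, `#𝓞/I = ‖I‖`) and Thm. 27 (residue degrees); [Cohen1993] §4.8.2 (decomposition of primes, residue
degree `2` at `2`); [NeukirchANT1999] Ch. I §8 (Dedekind–Kummer).
-/

namespace Literature.NumberTheory.NumberFields

open NumberField

/-- **A four-element quotient containing a primitive cube root of unity is a field**: `#(R/I) = 4`, `2 ∈ I`, `ζ² + ζ + 1 ∈ I` ⟹ `I` maximal
(`R/I = {0, 1, z, z+1} ≅ 𝔽₄` with `z = ζ̄`, `z(z+1) = 1`). [cite: Marcus1977, Ch. 3 Thm. 27 (residue degree two)] [cite: Cohen1993, §4.8.2] -/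
theorem Ideal.isMaximal_of_card_quotient_eq_four {R : Type*} [CommRing R] (I : Ideal R) (h4 : Nat.card (R ⧸ I) = 4)
    (h2 : (2 : R) ∈ I) (ζ : R) (hζ : ζ ^ 2 + ζ + 1 ∈ I) : I.IsMaximal := by
  classical
  haveI : Finite (R ⧸ I) := Nat.finite_of_card_ne_zero (by rw [h4]; norm_num)
  letI : Fintype (R ⧸ I) := Fintype.ofFinite _
  set z : R ⧸ I := Ideal.Quotient.mk I ζ with hz
  have htwo : (2 : R ⧸ I) = 0 := by
    rw [← map_ofNat (Ideal.Quotient.mk I) 2, Ideal.Quotient.eq_zero_iff_mem]; exact h2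
  have hrel : z ^ 2 + z + 1 = 0 := by
    rw [hz, ← map_pow, ← map_add, ← map_one (Ideal.Quotient.mk I), ← map_add, Ideal.Quotient.eq_zero_iff_mem]; exact hζ
  have hcard : Fintype.card (R ⧸ I) = 4 := by rw [← Nat.card_eq_fintype_card, h4]
  haveI : Nontrivial (R ⧸ I) := Fintype.one_lt_card_iff_nontrivial.mp (by rw [hcard]; norm_num)
  have h10 : (1 : R ⧸ I) ≠ 0 := one_ne_zero
  have hneg : ∀ a : R ⧸ I, -a = a := fun a => by
    have : a + a = 0 := by rw [← two_mul, htwo, zero_mul]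
    exact (neg_eq_of_add_eq_zero_left this)
  -- the four classes `0, 1, z, z + 1` are pairwise distinct
  have hz0 : z ≠ 0 := by intro h; rw [h] at hrel; norm_num at hrel
  have hz1 : z ≠ 1 := by
    intro h; rw [h] at hrel
    have : (1 : R ⧸ I) ^ 2 + 1 + 1 = 2 + 1 := by ring
    rw [this, htwo, zero_add] at hrel; exact h10 hrel
  have hz10 : z + 1 ≠ 0 := by
    intro h
    have : z = -1 := eq_neg_of_add_eq_zero_left h
    rw [hneg] at this; exact hz1 this
  have hz11 : z + 1 ≠ 1 := by intro h; exact hz0 (by simpa using h)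
  have hzz1 : z + 1 ≠ z := by intro h; exact h10 (by simp at h)
  -- hence they exhaust `R/I`
  have huniv : (Finset.univ : Finset (R ⧸ I)) = {0, 1, z, z + 1} := by
    symm
    apply Finset.eq_of_subset_of_card_le (Finset.subset_univ _)
    rw [Finset.card_univ, hcard, Finset.card_insert_of_notMem (by simp [h10.symm, hz0.symm, hz10.symm]),
      Finset.card_insert_of_notMem (by simp [hz1.symm, hz11.symm]), Finset.card_pair hzz1.symm]
  have hcases : ∀ a : R ⧸ I, a = 0 ∨ a = 1 ∨ a = z ∨ a = z + 1 := by
    intro a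
    have ha : a ∈ ({0, 1, z, z + 1} : Finset (R ⧸ I)) := huniv ▸ Finset.mem_univ a
    simpa only [Finset.mem_insert, Finset.mem_singleton] using ha
  have hzinv : z * (z + 1) = 1 := by
    have h1 : z * (z + 1) = -1 := by linear_combination hrel
    rw [h1, hneg]
  -- `R/I` is a field
  have hfield : IsField (R ⧸ I) := by
    refine ⟨⟨0, 1, h10.symm⟩, mul_comm, ?_⟩
    intro a ha
    rcases hcases a with h | h | h | h
    · exact absurd h ha
    · exact ⟨1, by rw [h, one_mul]⟩
    · exact ⟨z + 1, by rw [h, hzinv]⟩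
    · exact ⟨z, by rw [h, mul_comm, hzinv]⟩
  exact Ideal.Quotient.maximal_of_isField I hfield

/-- **A principal ideal of norm `4` whose generator divides `2` and some `ζ² + ζ + 1` is prime** (the dyadic prime element of residue degree `2`
of a number field: `𝓞 K/(η) ≅ 𝔽₄`), and its generator is a prime element. [cite: Marcus1977, Ch. 5 Thm. 22 (c) and Ch. 3 Thm. 27] [cite: Cohen1993, §4.8.2] -/
theorem prime_of_absNorm_span_eq_four {K : Type*} [Field K] [NumberField K] (η : 𝓞 K)
    (hN : Ideal.absNorm (Ideal.span {η}) = 4) (h2 : η ∣ 2) (ζ : 𝓞 K) (hζ : η ∣ ζ ^ 2 + ζ + 1) :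
    (Ideal.span {η}).IsPrime ∧ Prime η := by
  have hcard : Nat.card (𝓞 K ⧸ Ideal.span {η}) = 4 := by
    rw [← Submodule.cardQuot_apply, ← Ideal.absNorm_apply, hN]
  have hmax := Ideal.isMaximal_of_card_quotient_eq_four (Ideal.span {η}) hcard (Ideal.mem_span_singleton.mpr h2) ζ
    (Ideal.mem_span_singleton.mpr hζ)
  have hη0 : η ≠ 0 := by
    intro h0
    rw [h0, Ideal.span_singleton_zero, Ideal.absNorm_bot] at hN
    norm_num at hN
  exact ⟨hmax.isPrime, (Ideal.span_singleton_prime hη0).mp hmax.isPrime⟩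

end Literature.NumberTheory.NumberFields
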